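import Summits.BirchSwinnertonDyer.BirchSwinnertonDyer.Theorems.CMKolyvaginAtInertTwoPairSupplyPairBoundAtTwo
import Summits.BirchSwinnertonDyer.BirchSwinnertonDyer.Theorems.CMKolyvaginAtInertTwoShaCountCompositeAtTwo
import HarnessLib

/-!
# Route `CMKolyvaginAtInertTwo`, crux `CMKolyvaginExactAtInertTwo` (stmt-BirchSwinnertonDyer-24277):
# SUPPLIER of the two-member data, VII — COMPOSITE `d_K`: `stub_upper` UP TO THE GENUS DEFECT,
# `#Ш(E_K)(2) · 2 ≤ 2^{2M₀} · 2^{Σ}` for EVERY odd `d_K` on H₂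

Seat `bsd-line-cmk2-p1` g18 (cell `bsd-print-cf2`); helper (`--supports stmt-BirchSwinnertonDyer-24277`).
THEOREMS ONLY: no definition, no named fact, no `sorry`; no item is closed; BSD is not proved by this.

File VI's pair bound `#Ш(E)(2)·#Ш(E^{(d_K)})(2) ≤ 2^{2M₀}` (every odd `d_K ≠ −3`) combined with g15's count identity for composite
`d_K` (`ShaCountTwo.card_primaryComponent_sha_two_baseChange_mul_two_eq_of_heegnerData_of_facts`:
`#Ш(E_K)(2)·2 = n_E · #Ш(E)(2)·#Ш(E^{(d_K)})(2) · 2^{Σ}`, `n_E = 1` as `Δ < 0` on H₂,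
`Σ = Σ_{q ∣ d_K} ([(Δ/q) = −1] + 2[(Δ/q) = 1 ∧ a_q even])`) gives

* `card_primaryComponent_sha_two_baseChange_mul_two_le_of_printedInputs` — **`#Ш(E_K)(2) · 2 ≤ 2^{2M₀} · 2^{Σ}`**, i.e.
  `#Ш(E_K)(2) ≤ 2^{2M₀ + Σ − 1}`, for every odd `d_K ≠ −3` on H₂, modulo the route's four published inputs and Gross 1991
  Prop. 3.7 (2) by name. For prime `|d_K|` the defect is `Σ = 1` (g15 `…ShaCountJacobiCompositeAtTwo`) and this is file V's
  `stub_upper` conclusion; for `Σ ≥ 2` it is the honest reach of Kolyvagin's `ℚ`-pair method at `2` (KERNEL-STATUS §18.4 (i)):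
  the missing `2^{Σ−1}` is the `2`-part of the twist's Tamagawa numbers at the primes of `d_K`, which the pair argument does not see;
* `card_primaryComponent_sha_two_baseChange_le_pow_of_sum_defect_le_one` — **`stub_upper`'s conclusion `#Ш(E_K)(2) ≤ 2^{2M₀}` on the
  wider sub-habitat `Σ ≤ 1`** (prime `|d_K|`, and composite `d_K` with one-bit defect), same inputs.

References: [Kolyvagin1989Izv] §3, Thm. B_l (l = 2); [McCallumLMS1991] §5 Thm. 5.4 "≤"; [Milne1972ArithmeticAV] Thm. 1;
[Kramer1981] Prop. 3; [GrossZagier1986] I (6.3).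
-/

-- single-conjunct summit: `Summit.BirchSwinnertonDyer.BirchSwinnertonDyer.…` repeats the name by design
set_option linter.dupNamespace false
set_option autoImplicit false

noncomputable section

open scoped Classical

namespace Summit.BirchSwinnertonDyer.BirchSwinnertonDyer.Theorems.KolyvaginPairSupplyTwo

open WeierstrassCurve NumberField IsDedekindDomain Field
open Literature.NumberTheory.EllipticCurves Literature.NumberTheory.GaloisRepresentations
open Literature.NumberTheory.EllipticCurves.ModularForms Literature.NumberTheory.EllipticCurves.RingClassField
open Summit.BirchSwinnertonDyer.BirchSwinnertonDyer.Theorems.GenusExact.VisiblePairAtTwo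

variable (W : WeierstrassCurve ℚ) {K : Type} [Field K] [NumberField K]

/-- **`#Ш(E_K)(2) · 2 ≤ 2^{2M₀} · 2^{Σ}` FOR EVERY ODD `d_K` ON H₂** (`stub_upper` up to the genus defect `2^{Σ−1}`), modulo
Gross–Zagier (all levels), GZK, modularity, Milne any-model and Gross 1991 Prop. 3.7 (2) by name. [cite: Kolyvagin1989Izv, §3 (Thm. B_l at l = 2)]
[cite: McCallumLMS1991, §5 Thm. 5.4 "≤"] [cite: Milne1972ArithmeticAV, Thm. 1] [cite: Kramer1981, Prop. 3] -/
theorem card_primaryComponent_sha_two_baseChange_mul_two_le_of_printedInputs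
    (hGZ : ∀ (N : ℕ) [NeZero N] (W : WeierstrassCurve ℚ) (K : Type) [Field K] [NumberField K], gross_zagier N W K)
    (hGZK : rank_eq_analyticRank_of_analyticRank_le_one) (hmod : hasEntireLFunction_rat)
    (hMilneC : Milne1972.bsdQuotient_baseChange_quadratic_anyModel)
    [W.IsElliptic] [W.IsGloballyMinimal] [NeZero (W.conductorNorm ℤ)]
    (hCM : W.HasCM) (hin : Literature.NumberTheory.EllipticCurves.Rank1Residual.CMInert W 2)
    (hρ : W.HasSurjectiveModNGaloisRep 2) (hT : Odd W.tamagawaProduct) (hK : IsImaginaryQuadratic K)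
    (hoddK : Odd (NumberField.discr K)) (h3 : NumberField.discr K ≠ -3)
    (hH : SatisfiesHeegnerHypothesis (W.conductorNorm ℤ) K)
    (h372 : GrossLMS1991.prop37_2_reductionCongruence_inert (W.conductorNorm ℤ) W K)
    (Dt : ModularParametrizationData W (W.conductorNorm ℤ)) (β : ℤ) (ιK : K →+* ℂ) (d₁ : KolyvaginHeegnerData Dt β ιK 1)
    (hy : ¬ IsOfFinAddOrder d₁.derivedPoint) (M₀ : ℕ)
    (hdiv : ∃ Q : (W.baseChange (ringClassField K ιK 1)).toAffine.Point, ((2 ^ M₀ : ℕ) : ℤ) • Q = d₁.derivedPoint)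
    (hndiv : ¬ ∃ Q : (W.baseChange (ringClassField K ιK 1)).toAffine.Point,
      ((2 ^ (M₀ + 1) : ℕ) : ℤ) • Q = d₁.derivedPoint) :
    Nat.card (AddCommGroup.primaryComponent (W.baseChange K).sha 2) * 2 ≤
      2 ^ (2 * M₀) * 2 ^ ∑ q ∈ (NumberField.discr K).natAbs.primeFactors,
        ((if jacobiSym W.Δ.num q = -1 then 1 else 0) +
          (if jacobiSym W.Δ.num q = 1 ∧ Even (W.frobeniusTrace q) then 2 else 0)) := by
  obtain ⟨-, hid⟩ := ShaCountTwo.card_primaryComponent_sha_two_baseChange_mul_two_eq_of_heegnerData_of_facts hGZ hGZK hmod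
    hMilneC W hρ K hK hoddK hH Dt β ιK d₁ hy
  have hpair := card_primaryComponent_mul_le_two_pow_of_printedInputs W hGZ hGZK hmod hCM hin hρ hT hK hoddK h3 hH h372 Dt β ιK
    d₁ hy M₀ hdiv hndiv
  have hΔ : ¬ 0 < W.Δ := not_lt.mpr (KolyvaginEigenTwo.Δ_neg_of_cmInert_two W hCM hin hρ).le
  rw [hid, if_neg hΔ, one_mul]
  exact Nat.mul_le_mul_right _ hpair

/-- **`stub_upper` ON THE WIDER SUB-HABITAT `Σ ≤ 1`** (every odd `d_K` whose genus defect is at most one bit — e.g. `|d_K|` prime,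
where `Σ = 1` by g15's Jacobi argument, but also composite `d_K` with exactly one prime `q ∣ d_K` inert in the CM field and
`a_q` odd at the split ones): `#Ш(E_K)(2) ≤ 2^{2M₀}`, modulo the same inputs. [cite: Kolyvagin1989Izv, §3 (Thm. B_l at l = 2)]
[cite: McCallumLMS1991, §5 Thm. 5.4 "≤"] [cite: Milne1972ArithmeticAV, Thm. 1] -/
theorem card_primaryComponent_sha_two_baseChange_le_pow_of_sum_defect_le_one
    (hGZ : ∀ (N : ℕ) [NeZero N] (W : WeierstrassCurve ℚ) (K : Type) [Field K] [NumberField K], gross_zagier N W K)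
    (hGZK : rank_eq_analyticRank_of_analyticRank_le_one) (hmod : hasEntireLFunction_rat)
    (hMilneC : Milne1972.bsdQuotient_baseChange_quadratic_anyModel)
    [W.IsElliptic] [W.IsGloballyMinimal] [NeZero (W.conductorNorm ℤ)]
    (hCM : W.HasCM) (hin : Literature.NumberTheory.EllipticCurves.Rank1Residual.CMInert W 2)
    (hρ : W.HasSurjectiveModNGaloisRep 2) (hT : Odd W.tamagawaProduct) (hK : IsImaginaryQuadratic K)
    (hoddK : Odd (NumberField.discr K)) (h3 : NumberField.discr K ≠ -3)
    (hH : SatisfiesHeegnerHypothesis (W.conductorNorm ℤ) K)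
    (h372 : GrossLMS1991.prop37_2_reductionCongruence_inert (W.conductorNorm ℤ) W K)
    (hdef : ∑ q ∈ (NumberField.discr K).natAbs.primeFactors,
        ((if jacobiSym W.Δ.num q = -1 then 1 else 0) +
          (if jacobiSym W.Δ.num q = 1 ∧ Even (W.frobeniusTrace q) then 2 else 0)) ≤ 1)
    (Dt : ModularParametrizationData W (W.conductorNorm ℤ)) (β : ℤ) (ιK : K →+* ℂ) (d₁ : KolyvaginHeegnerData Dt β ιK 1)
    (hy : ¬ IsOfFinAddOrder d₁.derivedPoint) (M₀ : ℕ)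
    (hdiv : ∃ Q : (W.baseChange (ringClassField K ιK 1)).toAffine.Point, ((2 ^ M₀ : ℕ) : ℤ) • Q = d₁.derivedPoint)
    (hndiv : ¬ ∃ Q : (W.baseChange (ringClassField K ιK 1)).toAffine.Point,
      ((2 ^ (M₀ + 1) : ℕ) : ℤ) • Q = d₁.derivedPoint) :
    Nat.card (AddCommGroup.primaryComponent (W.baseChange K).sha 2) ≤ 2 ^ (2 * M₀) := by
  have h := card_primaryComponent_sha_two_baseChange_mul_two_le_of_printedInputs W hGZ hGZK hmod hMilneC hCM hin hρ hT hK hoddK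
    h3 hH h372 Dt β ιK d₁ hy M₀ hdiv hndiv
  have h2 : 2 ^ (∑ q ∈ (NumberField.discr K).natAbs.primeFactors,
      ((if jacobiSym W.Δ.num q = -1 then 1 else 0) +
        (if jacobiSym W.Δ.num q = 1 ∧ Even (W.frobeniusTrace q) then 2 else 0))) ≤ 2 ^ 1 :=
    Nat.pow_le_pow_right two_pos hdef
  have h3' : Nat.card (AddCommGroup.primaryComponent (W.baseChange K).sha 2) * 2 ≤ 2 ^ (2 * M₀) * 2 := by
    calc _ ≤ 2 ^ (2 * M₀) * 2 ^ (∑ q ∈ (NumberField.discr K).natAbs.primeFactors,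
          ((if jacobiSym W.Δ.num q = -1 then 1 else 0) +
            (if jacobiSym W.Δ.num q = 1 ∧ Even (W.frobeniusTrace q) then 2 else 0))) := h
      _ ≤ 2 ^ (2 * M₀) * 2 ^ 1 := Nat.mul_le_mul_left _ h2
      _ = 2 ^ (2 * M₀) * 2 := by rw [pow_one]
  exact Nat.le_of_mul_le_mul_right h3' two_pos

end Summit.BirchSwinnertonDyer.BirchSwinnertonDyer.Theorems.KolyvaginPairSupplyTwo

end
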